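import Summits.AtomisticToContinuum.Crystallization.Theorems.OverbindingBudgetAffineCompressedCutEstablish

/-!
# NODE g82 «SharpA», toward the open leaf NS♭₂ — part (iii), the SHARPENING STEP: the record's own charts re-measured along short
# label paths (rider S0–S2 of the «Sharp(β)» plan, POINTERS-g83 §4d; potential-free)

Route `OverbindingBudget` (Crystallization), crux `RobustDefectLimitWindows` (stmt-AtomisticToContinuum-31280), decomp-a2c lens 4, generation 82.
Open leaf of record: `…OverbindingBudgetAffineCompressedCutFirst….NearFieldSlackMinSecond 12 (1/25)` («NS♭₂») ⟸ 79K ⟸ LR(r₁) (critic row 1428 (b));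
(i) chains ✓, (ii) LR(106/25) ✓ (`…CompressedCutReading.layer_rigidity_record`), (iii) the energy inequality: reduced in the tree to ONE inner inequality
(`…CompressedCutOuter.inner_sub_tail_le_nearLoad`), whose finite label sum needs the positions of the inner sites to accuracy `dR ν p`, `p ≤ 10`
(the record exports the uniform `dR ν 31 ≈ 0.37·ν`, which is not enough: LEDGER of record, critic row 1474 (B)).

WHY THIS FILE.  The layer-rigidity record establishes every label of the `106/25·nn_i`-ball with a chart `M_λ` carrying the site's pattern onto an aligned copy
`C_λ`, but with the uniform link / position budget `(tauR ν 31, dR ν 31)`.  «Sharp(β)» RE-MEASURES the record's own charts along label paths of length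
`p = |ℓ| + hexdist ≤ 10` from `i`, WITHOUT kernel tables and WITHOUT cocycles: one step `j → k′` (labels `λ → λ + x`, `x ∈ C_λ` first-shell) takes the
SHARP establishment `(τ, D)` of the parent's record chart and returns the sharp establishment `(τ + η, D + 10⁻⁴·nn_j + τ)` of the CHILD'S RECORD CHART
`M′` (§3 `sharp_step`).  The one new ingredient is the CROSS-COPY CHART IDENTIFICATION (§2 `chart_eq_of_exactDict`): the transported chart `M ∘ R₁`
(`R₁` the exact dictionary of the bond, `…Establish.bond_exact`) and the record chart `M′` of the child are both linked to the base frame, hence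
`(τ + η + τ′)/β`-close (`…Establish.charts_close`); on the three dictionary partners `w₀, w_b, w_c` (back-pointer and the partners of a tetrahedral frame
`b, c` at `v`, `…Step.tetra_exists_pattern`) BOTH charts take values in the model lattice `mv(T3)`, whose points are `1/√18`-separated (§1
`eq_of_mv_close`), so they agree there, and the partners span `ℝ³` (`…Op.linearIndependent_of_tetra` through `R₁`), so `M ∘ R₁ = M′`
(`…Exact.linearMap_eq_of_eq_on_triple`) — the record chart inherits the sharp link.  Contrast `…SeedTwo.estab_chart_unique`, which needs the SAME copy
on both sides; here the copies `C`, `C′` are arbitrary.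
* §1 `tsub_ne_zero_of_ne`, `one_le_tsq_of_ne_zero`, ★ `eq_of_mv_close` (`18·‖mv V − mv W‖² < 1 ⇒ V = W`).
* §2 ★★ `chart_eq_of_exactDict` (smallness hypothesis `6·(τ + τ′) < β`, i.e. `36(τ+τ′)² < β²` against pattern norms `≤ √2`).
* §3 ★★ `sharp_step` (ball data exactly as `…Establish.estab_child_one`; closeness hypothesis `(D + 10⁻⁴·nn_j + τ) + D′ < nn_{k′}` for
  `…Establish.site_eq_of_close`; returns the record's site, chart and copy with the sharp constants).
Next («SharpB», g83): the column induction over `ℓ` and the ring induction over `lnorm` (`…Seed.hex_descent`) iterate `sharp_step` from the seed, giving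
`‖y k − y i − B (mv λ)‖ ≤ dR ν (|ℓ| + lnorm w / 6)` for every inner label; then «Inner» (the stacking-free class tables) closes (iii).

Deps: `…CompressedCutEstablish` only.  No `instance`, no `notation`, no `set_option`, no new definitions, no axioms, 0 sorry.
-/

namespace Summit.AtomisticToContinuum.Crystallization.Theorems.OverbindingBudgetAffineCompressedCutSharpA

open Literature.Geometry.DiscreteGeometry (nearestDist nearestDist_nonneg nearestDist_le_dist fccTwoShellPattern hcpTwoShellPattern
  norm_le_sqrt_two_of_mem_twoShellPattern)
open Summit.AtomisticToContinuum.Crystallization.Theorems.OverbindingBudgetAffineCompressedCutKernel (T3 tsub tadd tneg tsq)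
open Summit.AtomisticToContinuum.Crystallization.Theorems.OverbindingBudgetAffineCompressedCutStep (tetra_exists_pattern partners_tetra)
open Summit.AtomisticToContinuum.Crystallization.Theorems.OverbindingBudgetAffineCompressedCutOp (linearIndependent_of_tetra)
open Summit.AtomisticToContinuum.Crystallization.Theorems.OverbindingBudgetAffineCompressedCutExact (ExactDict linearMap_eq_of_eq_on_triple)
open Summit.AtomisticToContinuum.Crystallization.Theorems.OverbindingBudgetAffineCompressedCutCharts (mv mv_tsub mv_tneg norm_mv_sq norm_mv_eq_one_iff
  Carries)
open Summit.AtomisticToContinuum.Crystallization.Theorems.OverbindingBudgetAffineCompressedCutEstablish (Estab child_position bond_exact link_comp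
  link_nonneg charts_close site_eq_of_close)

variable {N : ℕ}

/-! ## §1  The model lattice is `1/√18`-separated -/

/-- `V ≠ W ⇒ V − W ≠ 0` for integer triples. [this file] -/
theorem tsub_ne_zero_of_ne {V W : T3} (h : V ≠ W) : tsub V W ≠ (0, 0, 0) := by
  intro h0
  apply h
  obtain ⟨a, b, c⟩ := V
  obtain ⟨a', b', c'⟩ := W
  simp only [tsub, Prod.mk.injEq] at h0
  obtain ⟨h1, h2, h3⟩ := h0
  simp only [Prod.mk.injEq]
  omega

/-- A non-zero integer triple has `tsq ≥ 1`. [this file] -/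
theorem one_le_tsq_of_ne_zero {a : T3} (h : a ≠ (0, 0, 0)) : 1 ≤ tsq a := by
  obtain ⟨p, q, r⟩ := a
  simp only [tsq]
  by_contra hlt
  push Not at hlt
  have h0 : p * p + q * q + r * r = 0 := by nlinarith [mul_self_nonneg p, mul_self_nonneg q, mul_self_nonneg r]
  have hp : p = 0 := mul_self_eq_zero.mp (by nlinarith [mul_self_nonneg p, mul_self_nonneg q, mul_self_nonneg r])
  have hq : q = 0 := mul_self_eq_zero.mp (by nlinarith [mul_self_nonneg p, mul_self_nonneg q, mul_self_nonneg r])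
  have hr : r = 0 := mul_self_eq_zero.mp (by nlinarith [mul_self_nonneg p, mul_self_nonneg q, mul_self_nonneg r])
  exact h (by rw [hp, hq, hr])

/-- ★ **DISCRETENESS OF THE MODEL LATTICE.**  Two model vectors closer than `1/√18` are equal: `18·‖mv V − mv W‖² < 1 ⇒ V = W`. [this file] -/
theorem eq_of_mv_close {V W : T3} (h : 18 * ‖mv V - mv W‖ ^ 2 < 1) : V = W := by
  by_contra hne
  have hsq : ‖mv V - mv W‖ ^ 2 = (tsq (tsub V W) : ℝ) / 18 := by rw [← mv_tsub]; exact norm_mv_sq _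
  have h1 : (1 : ℝ) ≤ tsq (tsub V W) := by exact_mod_cast one_le_tsq_of_ne_zero (tsub_ne_zero_of_ne hne)
  rw [hsq] at h
  linarith

/-! ## §2  CROSS-COPY CHART IDENTIFICATION through the exact dictionary -/

/-- ★★ **CHART IDENTIFICATION.**  Site `j` (pattern `P j ∈ {fcc, hcp}`, chart `M` carrying `P j` onto `C`, first-shell point `v`), child `k` (pattern `P k`,
chart `M′` carrying `P k` onto `C′`), `R₁` an exact dictionary of the bond; both `M ∘ R₁` and `M′` linked to one base frame `B` (lower bound `β`) through the
same frame map `T` with links `τ, τ′`, and `6(τ + τ′) < β`.  Then `M ∘ R₁ = M′`. [this file] -/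
theorem chart_eq_of_exactDict {y : Fin N → EuclideanSpace ℝ (Fin 3)} {j k : Fin N} {P : Fin N → Finset (EuclideanSpace ℝ (Fin 3))}
    {f : Fin N → EuclideanSpace ℝ (Fin 3) → EuclideanSpace ℝ (Fin 3)}
    (hPj : P j = fccTwoShellPattern ∨ P j = hcpTwoShellPattern) (hPk : P k = fccTwoShellPattern ∨ P k = hcpTwoShellPattern)
    {v : EuclideanSpace ℝ (Fin 3)} (hv : v ∈ P j) (hv1 : ‖v‖ = 1)
    {M M' R₁ : EuclideanSpace ℝ (Fin 3) →ₗᵢ[ℝ] EuclideanSpace ℝ (Fin 3)} {C C' : List T3}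
    (hC : Carries M (P j) C) (hC' : Carries M' (P k) C') (hD : ExactDict y j (P j) (P k) (f j) (f k) v R₁)
    {B : EuclideanSpace ℝ (Fin 3) →ₗ[ℝ] EuclideanSpace ℝ (Fin 3)} {β τ τ' : ℝ} (hB : ∀ z, β * ‖z‖ ≤ ‖B z‖)
    {T : EuclideanSpace ℝ (Fin 3) → EuclideanSpace ℝ (Fin 3)}
    (hl : ∀ x, ‖T x - B ((M.comp R₁) x)‖ ≤ τ * ‖x‖) (hl' : ∀ x, ‖T x - B (M' x)‖ ≤ τ' * ‖x‖) (hsmall : 6 * (τ + τ') < β) :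
    ∀ x, (M.comp R₁) x = M' x := by
  have hcl := charts_close hB hl hl'
  have hτ := link_nonneg hl
  have hτ' := link_nonneg hl'
  have hβ : 0 < β := by linarith
  -- pointwise agreement on every pattern point of `k` where the transported chart is lattice-valued
  have agree : ∀ w ∈ P k, ∀ X : T3, (M.comp R₁) w = mv X → (M.comp R₁) w = M' w := by
    intro w hw X hX
    obtain ⟨X', -, hX'⟩ := hC'.1 w hw
    have h1 := hcl w
    have h2 : ‖w‖ ≤ Real.sqrt 2 := norm_le_sqrt_two_of_mem_twoShellPattern hPk hw
    have h3 : β * ‖(M.comp R₁) w - M' w‖ ≤ (τ + τ') * Real.sqrt 2 :=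
      h1.trans (mul_le_mul_of_nonneg_left h2 (by linarith))
    have hs : Real.sqrt 2 ^ 2 = 2 := Real.sq_sqrt (by norm_num)
    have h4 : (β * ‖(M.comp R₁) w - M' w‖) ^ 2 ≤ ((τ + τ') * Real.sqrt 2) ^ 2 :=
      pow_le_pow_left₀ (mul_nonneg hβ.le (norm_nonneg _)) h3 2
    have h5 : ((τ + τ') * Real.sqrt 2) ^ 2 = 2 * (τ + τ') ^ 2 := by rw [mul_pow, hs]; ring
    have h6 : (6 * (τ + τ')) ^ 2 < β ^ 2 := pow_lt_pow_left₀ hsmall (by linarith) two_ne_zero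
    have h7 : 18 * ‖(M.comp R₁) w - M' w‖ ^ 2 < 1 := by
      by_contra h8
      push Not at h8
      have h9 : β ^ 2 * 1 ≤ β ^ 2 * (18 * ‖(M.comp R₁) w - M' w‖ ^ 2) := mul_le_mul_of_nonneg_left h8 (sq_nonneg β)
      have h10 : β ^ 2 * (18 * ‖(M.comp R₁) w - M' w‖ ^ 2) = 18 * (β * ‖(M.comp R₁) w - M' w‖) ^ 2 := by ring
      rw [h10] at h9
      rw [h5] at h4
      linarith
    rw [hX, hX'] at h7 ⊢
    rw [eq_of_mv_close h7]
  -- three independent partner points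
  obtain ⟨b, hb, c, hc, hb1, hc1, dvb, dvc, -, ivb, ivc, ibc⟩ := tetra_exists_pattern hPj hv hv1
  obtain ⟨g0, g1, g2, g01, g02, g12⟩ := partners_tetra hv1 hb1 hc1 ivb ivc ibc
  have nbv : ‖b - v‖ = 1 := by rw [← dist_eq_norm, dist_comm]; exact dvb
  have ncv : ‖c - v‖ = 1 := by rw [← dist_eq_norm, dist_comm]; exact dvc
  have hbne : b ≠ v := fun h => by rw [h, sub_self, norm_zero] at nbv; exact zero_ne_one nbv
  have hcne : c ≠ v := fun h => by rw [h, sub_self, norm_zero] at ncv; exact zero_ne_one ncv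
  have hble : ‖b - v‖ ≤ 149 / 100 := by rw [nbv]; norm_num
  have hcle : ‖c - v‖ ≤ 149 / 100 := by rw [ncv]; norm_num
  obtain ⟨w₀, hw₀, -, hRw₀⟩ := hD.1
  obtain ⟨w₁, hw₁, -, hRw₁⟩ := hD.2 b hb hbne hble
  obtain ⟨w₂, hw₂, -, hRw₂⟩ := hD.2 c hc hcne hcle
  obtain ⟨Xv, -, hMv⟩ := hC.1 v hv
  obtain ⟨Xb, -, hMb⟩ := hC.1 b hb
  obtain ⟨Xc, -, hMc⟩ := hC.1 c hc
  have hG0 : (M.comp R₁) w₀ = mv (tneg Xv) := by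
    rw [LinearIsometry.coe_comp, Function.comp_apply, hRw₀, map_neg, hMv, mv_tneg]
  have hG1 : (M.comp R₁) w₁ = mv (tsub Xb Xv) := by
    rw [LinearIsometry.coe_comp, Function.comp_apply, hRw₁, map_sub, hMb, hMv, mv_tsub]
  have hG2 : (M.comp R₁) w₂ = mv (tsub Xc Xv) := by
    rw [LinearIsometry.coe_comp, Function.comp_apply, hRw₂, map_sub, hMc, hMv, mv_tsub]
  have a0 := agree w₀ hw₀ _ hG0
  have a1 := agree w₁ hw₁ _ hG1
  have a2 := agree w₂ hw₂ _ hG2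
  have hli : LinearIndependent ℝ ![w₀, w₁, w₂] := by
    apply LinearIndependent.of_comp R₁.toLinearMap
    have hc3 : (R₁.toLinearMap : EuclideanSpace ℝ (Fin 3) → EuclideanSpace ℝ (Fin 3)) ∘ ![w₀, w₁, w₂] = ![-v, b - v, c - v] := by
      funext t
      fin_cases t <;> simp [hRw₀, hRw₁, hRw₂]
    rw [hc3]
    exact linearIndependent_of_tetra g0 g1 g2 g01 g02 g12
  have key := linearMap_eq_of_eq_on_triple (T := (M.comp R₁).toLinearMap) (T' := M'.toLinearMap) hli (fun t => by
    fin_cases t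
    · simpa using a0
    · simpa using a1
    · simpa using a2)
  intro x
  simpa using LinearMap.congr_fun key x

/-! ## §3  THE SHARP STEP -/

/-- ★★ **SHARP STEP.**  Ball data as in `…Establish.estab_child_one` (radius `r` about `i`); base frame `B` bounded below by `β`; the parent `j` established with
its (record) chart `M` onto `C`, label `λ`, SHARP link `τ` and position `D`; `x ∈ C` first-shell with the predicted child position in the ball; the record's
establishment of the child label `λ + x` at the site `k′` (chart `M′` onto `C′`, link `τ′`, position `D′`) with `(D + 10⁻⁴·nn_j + τ) + D′ < nn_{k′}` and
`6(τ + η + τ′) < β`, `η = (5/2)(2·10⁻⁴·nn_j + 10⁻⁴·nn_{k′})`.  Then the record's site, chart and copy carry the SHARP constants: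
`Estab y A P B i k′ M′ C′ (λ + x) (τ + η) (D + 10⁻⁴·nn_j + τ)`. [this file] -/
theorem sharp_step {y : Fin N → EuclideanSpace ℝ (Fin 3)} (hy : Function.Injective y) {r : ℝ} {i j k' : Fin N}
    {A : Fin N → (EuclideanSpace ℝ (Fin 3) →ₗ[ℝ] EuclideanSpace ℝ (Fin 3))} {Qf : Fin N → (EuclideanSpace ℝ (Fin 3) →ₗᵢ[ℝ] EuclideanSpace ℝ (Fin 3))}
    {P : Fin N → Finset (EuclideanSpace ℝ (Fin 3))} {f : Fin N → EuclideanSpace ℝ (Fin 3) → EuclideanSpace ℝ (Fin 3)}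
    {B : EuclideanSpace ℝ (Fin 3) →ₗ[ℝ] EuclideanSpace ℝ (Fin 3)} {β : ℝ}
    (hP : ∀ j, dist (y j) (y i) ≤ r → (P j = fccTwoShellPattern ∨ P j = hcpTwoShellPattern))
    (hA : ∀ j, dist (y j) (y i) ≤ r → ∀ v ∈ P j, ‖A j v - Qf j v‖ ≤ 1 / 1000)
    (hf : ∀ j, dist (y j) (y i) ≤ r → ∀ v ∈ P j, f j v ∈ Set.range y ∧ dist (f j v) (y j + nearestDist y j • A j v) ≤ 1 / 10 ^ 4 * nearestDist y j)
    (hinj : ∀ j, dist (y j) (y i) ≤ r → Set.InjOn (f j) ↑(P j))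
    (hex : ∀ j, dist (y j) (y i) ≤ r → ∀ m, m ≠ j → dist (y m) (y j) ≤ (3 / 2 + 1 / 450) * nearestDist y j → ∃ v ∈ P j, f j v = y m)
    (hB : ∀ z, β * ‖z‖ ≤ ‖B z‖) (hj : dist (y j) (y i) ≤ r)
    {M : EuclideanSpace ℝ (Fin 3) →ₗᵢ[ℝ] EuclideanSpace ℝ (Fin 3)} {C : List T3} {lam : T3} {τ D : ℝ} (hE : Estab y A P B i j M C lam τ D)
    {x : T3} (hxC : x ∈ C) (hx18 : tsq x = 18) (hball : ‖B (mv (tadd lam x))‖ + (D + 1 / 10 ^ 4 * nearestDist y j + τ) ≤ r)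
    {M' : EuclideanSpace ℝ (Fin 3) →ₗᵢ[ℝ] EuclideanSpace ℝ (Fin 3)} {C' : List T3} {τ' D' : ℝ}
    (hE' : Estab y A P B i k' M' C' (tadd lam x) τ' D')
    (hclose : (D + 1 / 10 ^ 4 * nearestDist y j + τ) + D' < nearestDist y k')
    (hsmall : 6 * ((τ + 5 / 2 * (2 * (1 / 10 ^ 4) * nearestDist y j + 1 / 10 ^ 4 * nearestDist y k')) + τ') < β) :
    Estab y A P B i k' M' C' (tadd lam x) (τ + 5 / 2 * (2 * (1 / 10 ^ 4) * nearestDist y j + 1 / 10 ^ 4 * nearestDist y k'))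
      (D + 1 / 10 ^ 4 * nearestDist y j + τ) := by
  obtain ⟨v, hv, hMv⟩ := hE.1.2 x hxC
  have hv1 : ‖v‖ = 1 := by
    have h := (norm_mv_eq_one_iff x).2 hx18
    rwa [← hMv, M.norm_map] at h
  obtain ⟨k, hk⟩ := (hf j hj v hv).1
  have hposk : ‖y k - y i - B (mv (tadd lam x))‖ ≤ D + 1 / 10 ^ 4 * nearestDist y j + τ :=
    child_position hE (hf j hj) hv hv1 hMv hk.symm
  have hkr : dist (y k) (y i) ≤ r := by
    rw [dist_eq_norm]
    have e : y k - y i = (y k - y i - B (mv (tadd lam x))) + B (mv (tadd lam x)) := by abel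
    rw [e]
    exact (norm_add_le _ _).trans (by linarith)
  obtain ⟨-, -, -, R₁, hop, hDict⟩ := bond_exact hy hP hA hf hinj hex hj hkr hv hv1 hk.symm
  have hkk' : k = k' := site_eq_of_close hposk hE'.2.2 hclose
  subst hkk'
  have hlink := link_comp hE.2.1 hop
  have heq := chart_eq_of_exactDict (hP j hj) (hP k hkr) hv hv1 hE.1 hE'.1 hDict hB hlink hE'.2.1 hsmall
  exact ⟨hE'.1, fun z => by rw [← heq z]; exact hlink z, hposk⟩

end Summit.AtomisticToContinuum.Crystallization.Theorems.OverbindingBudgetAffineCompressedCutSharpA
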